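import Literature.AnabelianGeometry.SemiGraphs.PSCSeparatingCoveringsProofs

/-!
# [CombGC] Proposition 1.2 from the separating coverings, II: rows P12-L03 (Prop. 1.2 (ii)) and P12-L00, PROVED

Mochizuki, *A combinatorial version of the Grothendieck conjecture*, Tohoku Math. J. **59** (2007)
[CombGC], Prop. 1.2 pp. 8–9 [cite: MochizukiCombGC2007, Prop 1.2 pp.8-9].  Sequel (400-line rule) of the
PROOF-ONLY companion `PSCSeparatingCoveringsProofs.lean` (abc-iut-w5-d183; L3-lead ruling γ3-3) of
abc-iut-w4-d081's statements file `PSCSeparatingCoverings.lean` (sub-DAG `plan/L3/SUBDAG-CombGC-Prop12.md`):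

* **P12-L03** (`verticialEdgeLikeCommensurablyTerminal_of_separating`,
  `unrVerticialCommensurablyTerminal_of_separating`): Prop. 1.2 (ii) — "assertion (ii) follows formally
  from assertion (i) [cf. the derivation of [Mzk7], Corollary 2.7, (i), from [Mzk7], Proposition 2.6]":
  `γ' ∈ C_Π(γΠ_vγ⁻¹)` ⇒ the intersection is closed of finite index, hence open ⇒ by (i) AT EVERY LEVEL
  (part I, `sameVertex_of_isOpen`) the vertices `(v, Uγ)`, `(v, Uγ'γ)` of every `G_U` coincide ⇒
  `γ' ∈ ⋂_U U·γΠ_vγ⁻¹ = γΠ_vγ⁻¹` (part I, `commensurator_eq_of_levelwise`); edges and the unramified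
  (sturdy) clause likewise;
* `prop12_of_separating`: all five typed clauses of Prop. 1.2 (i)(ii) for the datum `G` from
  `G.SeparatingCoverings` (profinite `Π`);
* **P12-L00** (`openInterDeterminesComponentHolds_of_separating`,
  `commensurableTerminalityHolds_of_separating`): the printed Prop. 1.2 (i)/(ii)
  (`OpenInterDeterminesComponentHolds Ω`, `CommensurableTerminalityHolds Ω`, `PSCGraphicity.lean`) from
  `SeparatingCoveringsHolds Ω` and profiniteness of the `Π_G` of `Ω`-data (Def. 1.1 (ii): "the maximal
  pro-Σ quotient of the profinite fundamental group"; displayed inline hypothesis `hprof`, no new `Prop`).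

So the node `CombGC:Prop1.2` is reduced to the ONE origin-level statement P12-L01 + profiniteness.  Pure
group theory / topology; NO definition, nothing of [CombGC] asserted; nothing here takes a side on
[IUTchIII] Cor. 3.12.
-/

noncomputable section

namespace Literature.AnabelianGeometry.SemiGraphs

namespace PSCDatum

open scoped Pointwise

universe u

variable {P : Type u} [Group P] [TopologicalSpace P] (G : PSCDatum P)

/-! ## 4. P12-L03: Prop. 1.2 (ii) from (i) at every level -/

omit [TopologicalSpace P] in
/-- Membership in a double coset `U γ₀ A`, solved for the left factor: `g·γ₀ ∈ U γ₀ A` gives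
`g ∈ U · (γ₀ A γ₀⁻¹)`. [folklore] -/
private theorem mem_mul_conj_of_mul_mem_doubleCoset {U A : Subgroup P} {g γ₀ : P}
    (h : g * γ₀ ∈ DoubleCoset.doubleCoset γ₀ (U : Set P) (A : Set P)) :
    g ∈ (U : Set P) * ((ConjAct.toConjAct γ₀ • A : Subgroup P) : Set P) := by
  obtain ⟨u, hu, a, ha, heq⟩ := DoubleCoset.mem_doubleCoset.mp h
  refine Set.mem_mul.mpr ⟨u, hu, γ₀ * a * γ₀⁻¹, ?_, ?_⟩
  · rw [SetLike.mem_coe, Subgroup.mem_pointwise_smul_iff_inv_smul_mem]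
    simpa [ConjAct.smul_def, mul_assoc] using ha
  · calc u * (γ₀ * a * γ₀⁻¹) = (u * γ₀ * a) * γ₀⁻¹ := by group
      _ = g * γ₀ * γ₀⁻¹ := by rw [← heq]
      _ = g := by group

/-- The representative edge-like subgroups are closed. [cite: MochizukiCombGC2007, Def 1.1(ii) p.6] -/
theorem isClosed_edgeGp (e : G.graph.N ⊕ G.graph.C) : IsClosed (G.edgeGp e : Set P) := by
  rcases e with e | c
  · exact G.isClosed_nodeGp e
  · exact G.isClosed_cuspGp c

section Closures

variable [IsTopologicalGroup P]

/-- `Ker(Π_G ↠ Π^unr_G)` is closed. [cite: MochizukiCombGC2007, Def 1.1(ii) p.7] -/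
theorem isClosed_unrKer : IsClosed (G.unrKer : Set P) := Subgroup.isClosed_topologicalClosure _

end Closures


section L03

variable [IsTopologicalGroup P] [CompactSpace P] [TotallyDisconnectedSpace P]

/-- (ii) for the verticial subgroup `γΠ_vγ⁻¹`: `γ' ∈ C_Π(γΠ_vγ⁻¹)` ⇒ at every open normal `U` the vertices
`(v, Uγ)`, `(v, Uγ'γ)` coincide ⇒ `γ' ∈ ⋂_U U·γΠ_vγ⁻¹ = γΠ_vγ⁻¹`. [cite: MochizukiCombGC2007, Prop 1.2(ii) p.9] -/
theorem commensurator_vertGp_eq_of_separating (hsep : G.VerticialSeparatingCoverings)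
    (v : G.graph.V) (γ : ConjAct P) :
    Subgroup.Commensurable.commensurator (γ • G.vertGp v) = γ • G.vertGp v := by
  refine commensurator_eq_of_levelwise (K := ⊥) (isClosed_conj_smul (G.isClosed_vertGp v) γ) bot_le
    fun U hUo hUn _ g hrel => ?_
  haveI := hUn
  have hrel' : IsOpen (((↑) : ↥(U ⊓ γ • G.vertGp v) → P) ⁻¹'
      (((ConjAct.toConjAct g * γ) • G.vertGp v : Subgroup P) : Set P)) := by
    rw [mul_smul]
    exact hrel
  obtain ⟨-, hmem⟩ := G.sameVertex_of_isOpen hsep U hUo v v γ (ConjAct.toConjAct g * γ) hrel'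
  have hmem' : g * ConjAct.ofConjAct γ ∈
      DoubleCoset.doubleCoset (ConjAct.ofConjAct γ) (U : Set P) (G.vertGp v : Set P) := by
    simpa using hmem
  simpa using mem_mul_conj_of_mul_mem_doubleCoset hmem'

/-- (ii) for the edge-like subgroup `γΠ_eγ⁻¹`. [cite: MochizukiCombGC2007, Prop 1.2(ii) p.9] -/
theorem commensurator_edgeGp_eq_of_separating (hsep : G.EdgeLikeSeparatingCoverings)
    (e : G.graph.N ⊕ G.graph.C) (γ : ConjAct P) :
    Subgroup.Commensurable.commensurator (γ • G.edgeGp e) = γ • G.edgeGp e := by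
  refine commensurator_eq_of_levelwise (K := ⊥) (isClosed_conj_smul (G.isClosed_edgeGp e) γ) bot_le
    fun U hUo hUn _ g hrel => ?_
  haveI := hUn
  have hrel' : IsOpen (((↑) : ↥(U ⊓ γ • G.edgeGp e) → P) ⁻¹'
      (((ConjAct.toConjAct g * γ) • G.edgeGp e : Subgroup P) : Set P)) := by
    rw [mul_smul]
    exact hrel
  obtain ⟨-, hmem⟩ := G.sameEdge_of_isOpen hsep U hUo e e γ (ConjAct.toConjAct g * γ) hrel'
  have hmem' : g * ConjAct.ofConjAct γ ∈
      DoubleCoset.doubleCoset (ConjAct.ofConjAct γ) (U : Set P) (G.edgeGp e : Set P) := by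
    simpa using hmem
  simpa using mem_mul_conj_of_mul_mem_doubleCoset hmem'

/-- (ii) for the unramified verticial subgroup `γΠ_vγ⁻¹·Ker` (`G` sturdy): closed (`γΠ_vγ⁻¹` compact,
`Ker` closed normal), `g•(γΠ_vγ⁻¹·Ker) = gγΠ_v(gγ)⁻¹·Ker`, levels `U ⊇ Ker`, and
`U ∩ (A·Ker) = (U ∩ A)·Ker`. [cite: MochizukiCombGC2007, Prop 1.2(ii) p.9] -/
theorem commensurator_unrVertGp_eq_of_separating (hsep : G.UnrVerticialSeparatingCoverings)
    (hst : G.IsSturdy) (v : G.graph.V) (γ : ConjAct P) :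
    Subgroup.Commensurable.commensurator (γ • G.vertGp v ⊔ G.unrKer) = γ • G.vertGp v ⊔ G.unrKer := by
  have hAc : IsClosed ((γ • G.vertGp v : Subgroup P) : Set P) := isClosed_conj_smul (G.isClosed_vertGp v) γ
  have hBc : IsClosed ((γ • G.vertGp v ⊔ G.unrKer : Subgroup P) : Set P) := by
    rw [Subgroup.mul_normal]
    exact (G.isClosed_unrKer).mul_left_of_isCompact hAc.isCompact
  refine commensurator_eq_of_levelwise (K := G.unrKer) hBc le_sup_right fun U hUo hUn hKU g hrel => ?_
  haveI := hUn
  have hK : (ConjAct.toConjAct g • G.unrKer : Subgroup P) = G.unrKer :=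
    (inferInstance : G.unrKer.Normal).conjAct _
  -- the hypothesis, rewritten into the shape of `sameVertex_of_isOpen_unr`
  have hrel' : IsOpen (((↑) : ↥(U ⊓ (γ • G.vertGp v ⊔ G.unrKer)) → P) ⁻¹'
      (((ConjAct.toConjAct g * γ) • G.vertGp v ⊔ G.unrKer : Subgroup P) : Set P)) := by
    rw [mul_smul, ← hK, ← Subgroup.smul_sup, hK]
    exact hrel
  obtain ⟨-, hmem⟩ := G.sameVertex_of_isOpen_unr hsep hst U hUo hKU v v γ (ConjAct.toConjAct g * γ) hrel'
  have hmem' : g * ConjAct.ofConjAct γ ∈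
      DoubleCoset.doubleCoset (ConjAct.ofConjAct γ) (U : Set P) (G.vertGp v : Set P) := by
    simpa using hmem
  have hg : g ∈ (U : Set P) * ((γ • G.vertGp v : Subgroup P) : Set P) := by
    simpa using mem_mul_conj_of_mul_mem_doubleCoset hmem'
  exact Set.mul_subset_mul_left (SetLike.coe_subset_coe.mpr le_sup_left) hg

/-- **[CombGC] Prop. 1.2 (ii), verticial and edge-like subgroups, from the separating coverings** (row
P12-L03-VE): "The `Aᵢ` are commensurably terminal in `Π_G`" — "follows formally from assertion (i) [cf.
the derivation of [Mzk7], Corollary 2.7, (i), from [Mzk7], Proposition 2.6]".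
[cite: MochizukiCombGC2007, Prop 1.2(ii) p.8] -/
theorem verticialEdgeLikeCommensurablyTerminal_of_separating (hV : G.VerticialSeparatingCoverings)
    (hE : G.EdgeLikeSeparatingCoverings) : G.VerticialEdgeLikeCommensurablyTerminal := by
  rintro A (⟨v, γ, rfl⟩ | ⟨e, γ, rfl⟩ | ⟨c, γ, rfl⟩)
  · exact G.commensurator_vertGp_eq_of_separating hV v γ
  · exact G.commensurator_edgeGp_eq_of_separating hE (Sum.inl e) γ
  · exact G.commensurator_edgeGp_eq_of_separating hE (Sum.inr c) γ

/-- **[CombGC] Prop. 1.2 (ii), unramified verticial subgroups (`G` sturdy), from the separating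
`Π^unr`-coverings** (row P12-L03-U): "the `Bᵢ` are commensurably terminal in `Π^unr_G`".
[cite: MochizukiCombGC2007, Prop 1.2(ii) p.8] -/
theorem unrVerticialCommensurablyTerminal_of_separating (hU : G.UnrVerticialSeparatingCoverings) :
    G.UnrVerticialCommensurablyTerminal := by
  intro hst B hB
  obtain ⟨A, ⟨v, γ, rfl⟩, rfl⟩ := hB
  exact G.commensurator_unrVertGp_eq_of_separating hU hst v γ

/-- **[CombGC] Prop. 1.2 (i) and (ii) for the datum `G`** (all typed clauses) from profiniteness of `Π_G`
and the ONE origin-level statement `SeparatingCoverings` (row P12-L01). [cite: MochizukiCombGC2007, Prop 1.2 pp.8-9] -/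
theorem prop12_of_separating (h : G.SeparatingCoverings) :
    (G.VerticialOpenInterDeterminesVertex ∧ G.EdgeLikeOpenInterDeterminesEdge ∧
      G.UnrVerticialOpenInterDeterminesVertex) ∧
    (G.VerticialEdgeLikeCommensurablyTerminal ∧ G.UnrVerticialCommensurablyTerminal) :=
  ⟨⟨G.verticialOpenInterDeterminesVertex_of_separating h.1, G.edgeLikeOpenInterDeterminesEdge_of_separating h.2.1,
      G.unrVerticialOpenInterDeterminesVertex_of_separating h.2.2⟩,
    ⟨G.verticialEdgeLikeCommensurablyTerminal_of_separating h.1 h.2.1,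
      G.unrVerticialCommensurablyTerminal_of_separating h.2.2⟩⟩

end L03

/-! ## 5. P12-L00: the printed statements over the origin predicate `Ω` -/

section L00

variable (Ω : PSCOrigin.{u})

/-- **[CombGC] Prop. 1.2 (i) as printed** (`OpenInterDeterminesComponentHolds Ω`) from the
separating-coverings statement `SeparatingCoveringsHolds Ω` and profiniteness of the PSC-fundamental
groups of `Ω`-data (Def. 1.1 (ii), p. 6: "the maximal pro-Σ quotient of the profinite fundamental group";
displayed inline hypothesis, no new `Prop`). [cite: MochizukiCombGC2007, Prop 1.2(i) p.8] -/
theorem openInterDeterminesComponentHolds_of_separating (hsep : SeparatingCoveringsHolds Ω)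
    (hprof : ∀ ⦃Q : Type u⦄ [Group Q] [TopologicalSpace Q] [IsTopologicalGroup Q] (G : PSCDatum Q),
      Ω.IsOfPSCType G → CompactSpace Q ∧ TotallyDisconnectedSpace Q) :
    OpenInterDeterminesComponentHolds Ω := by
  intro Q _ _ _ G hG
  obtain ⟨hc, htd⟩ := hprof G hG
  exact (G.prop12_of_separating (hsep G hG)).1

/-- **[CombGC] Prop. 1.2 (ii) as printed** (`CommensurableTerminalityHolds Ω`) from
`SeparatingCoveringsHolds Ω` and profiniteness (displayed inline hypothesis).
[cite: MochizukiCombGC2007, Prop 1.2(ii) p.8] -/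
theorem commensurableTerminalityHolds_of_separating (hsep : SeparatingCoveringsHolds Ω)
    (hprof : ∀ ⦃Q : Type u⦄ [Group Q] [TopologicalSpace Q] [IsTopologicalGroup Q] (G : PSCDatum Q),
      Ω.IsOfPSCType G → CompactSpace Q ∧ TotallyDisconnectedSpace Q) :
    CommensurableTerminalityHolds Ω := by
  intro Q _ _ _ G hG
  obtain ⟨hc, htd⟩ := hprof G hG
  exact (G.prop12_of_separating (hsep G hG)).2

end L00

end PSCDatum

end Literature.AnabelianGeometry.SemiGraphs

end
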